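import Mathlib

/-!
# `Balaban1983to89.B7Ineq148` — kernel proof of the second-order Cauchy estimate (148) of B7 from (123)

CITATION HEADER (lean-in-tree rule 2026-08-18).  T. Bałaban, *Averaging operations for lattice gauge theories*,
Comm. Math. Phys. **98**, 17–51 (1985) [Balaban1985Averaging] (cell paper B7; `paper:balaban1985-cmp98-averaging`,
journal page = PDF page + 16), Sect. D pp. 34–41 [PDF 18–25], render-checked 2026-08-18 on
`b2b-balaban-ref1/pages/1985-cmp98-averaging/1985-cmp98-averaging-p018-x2.png`, `…-p020-x2.png`, `…-p021-x2.png`,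
`…-p023-x2.png`, `…-p024-x2.png`, `…-p025-x2.png`.  The paper is UNDER ADJUDICATION by the audit cell `pub-balaban`;
nothing of it is asserted here: every printed input enters as an explicit hypothesis, and what is proved is proved by the
kernel from Mathlib (Cauchy's estimate `Complex.norm_deriv_le_of_forall_mem_sphere_norm_le`).  This module is a NEW
sibling of `B7.lean` (r1/b07: abstract carriers `OneStep`/`KExp`, `Prop3Printed`, `Prop5Printed`) and of `B7Prop6Bound.lean`
(adv1); it imports only Mathlib and modifies nothing.

WHAT IS PRINTED (verbatim from the renders).
* p. 34 [PDF 18], (109) and after: *"|V₀(∂p) − 1| < α₀, V_{1,b} = e^{iA_b}, |A_b| < α₁, p, b ⊂ Ω′, (109) and A_b belong to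
  the complexified Lie algebra 𝔤ᶜ.  We would like to prove that for α₀, α₁ sufficiently small the average (V̄̄₁)_c is an
  analytic function of the variables A_b, b ⊂ B(c₋) ∪ B(c₊), c ⊂ Ω′⁽¹⁾, and to find bounds for (V̄̄₁)_c − 1, or rather
  (1/i) log(V̄̄₁)_c."*
* p. 36 [PDF 20], (121)–(123) and Proposition 3: *"Q(V₀, A, c) = (1/i) log(V̄̄₁)_c, (121) … Q(V₀, A, c) = L(Q(V₀)A)_c
  + C(V₀, A, c). (122)  C(V₀, A, c) is an analytic function of A whose Taylor's expansion begins with a second-order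
  polynomial (a quadratic form), and |C(V₀, A, c)| ≤ C₁L²|A|² < C₁(Lα₁)². (123)"* … *"**Proposition 3.** There exist
  constants C₁, c₃, c₃ ≤ c₂, such that for α₀, α₁ ≤ c₃ the function Q(V₀, A) = (1/i) log V̄̄₁ is an analytic function of
  A satisfying the equalities and bounds (122)–(124).  The constant C₁ depends on d and c₃ depends on d and L."*
* p. 37 [PDF 21], the regime in which the one-step function is re-applied: *"so |Q(U₀, ηA)| < 2α₁Lη ≤ 2α₁ ≤ c₃ for
  α₁ ≤ ½c₃, and we can apply Proposition 3 to function Q(Ū₀, ·) calculated at Q(U₀, ηA)."*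
* p. 39 [PDF 23], (137)–(138) and (140): *"If F(A) is a differentiable function defined at field configurations A on Ω,
  then the differential dF(A, δA) = (d/dt) F(A + tδA)|_{t=0} (137) is a linear functional of the variable δA … thus we have
  (d/dt) F(A + tδA)|_{t=0} = Σ_{b⊂Ω} η^d tr (δF(A)/δA_b) δA_b = ⟨δF(A)/δA, δA⟩. (138)"* … *"and Q″ is defined as
  (Q″A)_c = Σ_{b ⊂ B(c₋)∪B(c₊)} L^{−d} A_b. (140)  The constant C′₁ depends on d and L."*
* p. 40 [PDF 24], (148): *"Now we will generalize it to the whole function Q_k.  It is enough to prove it for C_k.  For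
  one-step renormalization transformation we have the bound |⟨δC(V₀, A)/δA, δA⟩| ≤ C″₁|A|Q″|δA| (148) following easily
  from general properties of the function C(V₀, A).  The constant C″₁ depends on d and L."*
* p. 41 [PDF 25]: (148) is consumed in (154) ("Using (143), (148), (149) we obtain the following bound") and hence in
  Proposition 5 (156)–(157) p. 42 with C₃ = 6C″₁; downstream B9 (CMP 99:389) (3.137) via (149).

WHAT THIS FILE CERTIFIES (GAPS G-B7-04, r1: "(148) asserted without proof … Needed: the one-paragraph proof with the
weight L^{−d} per variable made explicit"; disposition C-B7-D, b07: certified BY HAND with C″₁ = 4C₁L^{d+2} on |A| ≤ ½c₃ via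
Cauchy + Schwarz — here KERNEL-CHECKED, same constant, by a single Cauchy estimate on a complex line of radius |A|/|δA|).
The concrete model of the printed objects: the variables of C(V₀, ·, c) are A_b ∈ 𝔤ᶜ, b in the finite bond set
ι = {b ⊂ B(c₋) ∪ B(c₊)} (p. 34), so a configuration is `A : ι → G` with `G` any complex normed space (𝔤ᶜ with the operator
norm (17)–(20)) and `‖A‖` = the sup norm = sup_b |A_b| (Mathlib's Pi norm) — this is |A| restricted to the variables C_c
actually depends on, hence ≤ the printed global |A|, so every bound below implies the printed one; "analytic on |A_b| < c₃"
= `DifferentiableOn ℂ C (Metric.ball 0 c₃)` (the polydisc IS the sup-norm ball); the pairing (137)/(138) is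
`dPair C A δA = deriv (t ↦ C(A + tδA)) 0`; (140) on |δA| is `Qpp L d δA = Σ_b L^{−d}‖δA b‖`.
* `hasFDerivAt_zero_of_sq_bound`, `eq_zero_of_sq_bound` — the printed clause "Taylor's expansion begins with a second-order
  polynomial" FOLLOWS from the bound (123) alone: ‖C(A)‖ ≤ K‖A‖² on a ball forces C(0) = 0 and DC(0) = 0 (little-o).
* `norm_fderiv_apply_le_of_sq_bound_aux` — Cauchy's estimate on the line t ↦ C(A + tδA), |t| ≤ r, ‖A‖ + r‖δA‖ < R:
  ‖DC(A)δA‖ ≤ K(‖A‖ + r‖δA‖)²/r.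
* `norm_fderiv_apply_le_of_sq_bound` — with r = ‖A‖/‖δA‖ (admissible iff ‖A‖ < R/2): ‖DC(A)δA‖ ≤ 4K‖A‖‖δA‖ for
  ‖A‖ < R/2 (any complex normed spaces; no completeness needed).
* `norm_fderiv_apply_le_sum` — the weight per variable: δA = Σ_b (δA_b on bond b), linearity of DC(A) and
  ‖single_b(δA_b)‖_sup = ‖δA_b‖ give ‖DC(A)δA‖ ≤ 4K‖A‖ Σ_b ‖δA_b‖ = 4K L^d ‖A‖ (Q″|δA|)_c.
* `ineq148`, `ineq148Printed_of_123` — with K = C₁L² from (123): |⟨δC(V₀,A)/δA, δA⟩| ≤ 4C₁L^{d+2}·|A|·Q″|δA| for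
  |A| < ½c₃, i.e. (148) with the EXPLICIT constant C″₁ = 4C₁L^{d+2} ("depends on d and L" ✓ — and on C₁ = C₁(d)) on the
  half-polydisc, which contains every use-site of (148) (p. 37: arguments of norm < 2α₁L^jη ≤ α₁ ≤ ½c₃, L^jη ≤ ½ for j < k).
NOT certified here (printed inputs, hypotheses of the theorems): the analyticity of C(V₀, ·, c) on the polydisc and the
bound (123) (= Proposition 3, GAPS G-B7-02 / C-B7-D), and the locality sentence p. 34 (C_c depends only on A_b,
b ⊂ B(c₋) ∪ B(c₊)) by which (123) with the global |A| gives (123) with the restricted sup norm.  Location note for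
GAPS G-B7-04: (148) is printed on p. 40 [PDF 24] (the row says p. 41 [PDF 25], which carries its use in (154)).
-/

noncomputable section

namespace Literature.MathematicalPhysics.QuantumFieldTheory.Balaban1983to89.B7Ineq148

open Metric Set Filter Asymptotics
open scoped Topology

section General

variable {E F : Type*} [NormedAddCommGroup E] [NormedSpace ℂ E]
  [NormedAddCommGroup F] [NormedSpace ℂ F]

/-- The differential (137) of B7 p. 39 [PDF 23], *"dF(A, δA) = (d/dt) F(A + tδA)|_{t=0}"*, which (138) identifies with
the pairing *"⟨δF(A)/δA, δA⟩ = Σ_{b⊂Ω} η^d tr (δF(A)/δA_b) δA_b"*; typed with a complex parameter `t` (F is analytic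
in the complex variables A_b ∈ 𝔤ᶜ, p. 34), as the derivative at `0` of `t ↦ F(A + t•δA)`.
[cite: Balaban1985Averaging, (137)–(138) p.39] -/
def dPair (f : E → F) (A δA : E) : F :=
  deriv (fun t : ℂ => f (A + t • δA)) 0

/-- Chain rule along a complex line: if `f` has Fréchet derivative `f'` at `A + t•δA` then
`s ↦ f(A + s•δA)` has derivative `f' δA` at `t`. [folklore] -/
theorem hasDerivAt_line {f : E → F} {f' : E →L[ℂ] F} {A δA : E} {t : ℂ}
    (hf : HasFDerivAt f f' (A + t • δA)) :
    HasDerivAt (fun s : ℂ => f (A + s • δA)) (f' δA) t := by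
  have hl : HasDerivAt (fun s : ℂ => A + s • δA) δA t := by
    simpa using ((hasDerivAt_id t).smul_const δA).const_add A
  exact hf.comp_hasDerivAt t hl

/-- (137) = the Fréchet derivative applied to the direction: `dPair f A δA = Df(A) δA` whenever `f` is
(complex-)differentiable at `A`. [folklore] -/
theorem dPair_eq_fderiv {f : E → F} {A : E} (hf : DifferentiableAt ℂ f A) (δA : E) :
    dPair f A δA = fderiv ℂ f A δA := by
  have hfA : HasFDerivAt f (fderiv ℂ f A) (A + (0 : ℂ) • δA) := by
    simpa using hf.hasFDerivAt
  exact (hasDerivAt_line hfA).deriv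

omit [NormedSpace ℂ E] [NormedSpace ℂ F] in
/-- A quadratic bound `‖f z‖ ≤ K‖z‖²` on a ball around `0` forces `f 0 = 0`. [folklore] -/
theorem eq_zero_of_sq_bound {f : E → F} {R K : ℝ} (hR : 0 < R)
    (hK : ∀ z ∈ ball (0 : E) R, ‖f z‖ ≤ K * ‖z‖ ^ 2) : f 0 = 0 := by
  have h := hK 0 (mem_ball_self hR)
  simpa using h

/-- A quadratic bound `‖f z‖ ≤ K‖z‖²` on a ball around `0` forces the Fréchet derivative of `f` at `0` to be `0`
(so the bound (123) alone gives the printed clause "Taylor's expansion begins with a second-order polynomial",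
p. 36). [folklore] -/
theorem hasFDerivAt_zero_of_sq_bound {f : E → F} {R K : ℝ} (hR : 0 < R)
    (hK : ∀ z ∈ ball (0 : E) R, ‖f z‖ ≤ K * ‖z‖ ^ 2) :
    HasFDerivAt f (0 : E →L[ℂ] F) 0 := by
  have hf0 : f 0 = 0 := eq_zero_of_sq_bound hR hK
  rw [hasFDerivAt_iff_isLittleO_nhds_zero]
  simp only [zero_add, hf0, sub_zero, zero_apply]
  have h1 : (fun h : E => f h) =O[𝓝 (0 : E)] (fun h : E => ‖h‖ ^ 2) := by
    refine IsBigO.of_bound |K| ?_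
    filter_upwards [ball_mem_nhds (0 : E) hR] with z hz
    calc ‖f z‖ ≤ K * ‖z‖ ^ 2 := hK z hz
      _ ≤ |K| * ‖‖z‖ ^ 2‖ := by
          rw [Real.norm_of_nonneg (by positivity)]
          exact mul_le_mul_of_nonneg_right (le_abs_self K) (by positivity)
  exact h1.trans_isLittleO (isLittleO_norm_pow_id one_lt_two)

/-- Under the quadratic bound, `fderiv ℂ f 0 = 0`. [folklore] -/
theorem fderiv_zero_of_sq_bound {f : E → F} {R K : ℝ} (hR : 0 < R)
    (hK : ∀ z ∈ ball (0 : E) R, ‖f z‖ ≤ K * ‖z‖ ^ 2) : fderiv ℂ f (0 : E) = 0 :=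
  (hasFDerivAt_zero_of_sq_bound hR hK).fderiv

/-- **Cauchy's estimate on a complex line.**  If `f` is complex-differentiable on `ball 0 R` with `‖f z‖ ≤ K‖z‖²`
there (`K ≥ 0`), then for every `A`, `δA` and radius `r > 0` with `‖A‖ + r‖δA‖ < R` (so the closed disc
`{A + t•δA : |t| ≤ r}` lies in the ball): `‖Df(A) δA‖ ≤ K (‖A‖ + r‖δA‖)² / r` — Cauchy's inequality for the derivative at
`0` of `t ↦ f(A + t•δA)` from its sup on the circle `|t| = r`. [folklore] -/
theorem norm_fderiv_apply_le_of_sq_bound_aux {f : E → F} {R K : ℝ} (hK0 : 0 ≤ K)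
    (hf : DifferentiableOn ℂ f (ball 0 R))
    (hK : ∀ z ∈ ball (0 : E) R, ‖f z‖ ≤ K * ‖z‖ ^ 2)
    {A δA : E} {r : ℝ} (hr : 0 < r) (hAr : ‖A‖ + r * ‖δA‖ < R) :
    ‖fderiv ℂ f A δA‖ ≤ K * (‖A‖ + r * ‖δA‖) ^ 2 / r := by
  -- every point of the closed disc of radius `r` on the line lies in the ball
  have hle : ∀ t : ℂ, ‖t‖ ≤ r → ‖A + t • δA‖ ≤ ‖A‖ + r * ‖δA‖ := by
    intro t ht
    calc ‖A + t • δA‖ ≤ ‖A‖ + ‖t • δA‖ := norm_add_le _ _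
      _ = ‖A‖ + ‖t‖ * ‖δA‖ := by rw [norm_smul]
      _ ≤ ‖A‖ + r * ‖δA‖ := by gcongr
  have hmem : ∀ t : ℂ, ‖t‖ ≤ r → A + t • δA ∈ ball (0 : E) R := by
    intro t ht
    rw [mem_ball_zero_iff]
    exact (hle t ht).trans_lt hAr
  have hA : A ∈ ball (0 : E) R := by
    simpa using hmem 0 (by simp [hr.le])
  set g : ℂ → F := fun t => f (A + t • δA) with hg
  -- `g` is differentiable on the closed disc, hence `DiffContOnCl` on the open disc
  have hgd : DifferentiableOn ℂ g (closedBall 0 r) := by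
    intro t ht
    have ht' : ‖t‖ ≤ r := by simpa using ht
    have h1 : DifferentiableAt ℂ f (A + t • δA) :=
      hf.differentiableAt (isOpen_ball.mem_nhds (hmem t ht'))
    have h2 : DifferentiableAt ℂ (fun s : ℂ => A + s • δA) t := by fun_prop
    exact (h1.comp t h2).differentiableWithinAt
  have hdc : DiffContOnCl ℂ g (ball 0 r) := hgd.diffContOnCl_ball subset_rfl
  -- sup bound on the circle `|t| = r`
  have hsph : ∀ t ∈ sphere (0 : ℂ) r, ‖g t‖ ≤ K * (‖A‖ + r * ‖δA‖) ^ 2 := by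
    intro t ht
    have htr : ‖t‖ = r := by simpa using ht
    calc ‖g t‖ = ‖f (A + t • δA)‖ := rfl
      _ ≤ K * ‖A + t • δA‖ ^ 2 := hK _ (hmem t htr.le)
      _ ≤ K * (‖A‖ + r * ‖δA‖) ^ 2 := by
          have := hle t htr.le
          gcongr
  -- the derivative of `g` at `0` is `Df(A) δA`
  have hderiv : deriv g 0 = fderiv ℂ f A δA := by
    have hfA : HasFDerivAt f (fderiv ℂ f A) (A + (0 : ℂ) • δA) := by
      simpa using (hf.differentiableAt (isOpen_ball.mem_nhds hA)).hasFDerivAt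
    exact (hasDerivAt_line hfA).deriv
  have hC := Complex.norm_deriv_le_of_forall_mem_sphere_norm_le hr hdc hsph
  rwa [hderiv] at hC

/-- **The second-order Cauchy estimate** (the content of (148)).  If `f` is complex-differentiable on `ball 0 R` with
`‖f z‖ ≤ K‖z‖²` there (`K ≥ 0`), then for `‖A‖ < R/2` and every direction `δA`:
`‖Df(A) δA‖ ≤ 4K ‖A‖ ‖δA‖` (the auxiliary estimate at the optimal radius `r = ‖A‖/‖δA‖`; at `A = 0` the derivative
vanishes). [folklore] -/
theorem norm_fderiv_apply_le_of_sq_bound {f : E → F} {R K : ℝ} (hK0 : 0 ≤ K)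
    (hf : DifferentiableOn ℂ f (ball 0 R))
    (hK : ∀ z ∈ ball (0 : E) R, ‖f z‖ ≤ K * ‖z‖ ^ 2)
    {A : E} (hA : ‖A‖ < R / 2) (δA : E) :
    ‖fderiv ℂ f A δA‖ ≤ 4 * K * ‖A‖ * ‖δA‖ := by
  have hR : 0 < R := by have := norm_nonneg A; linarith
  by_cases hA0 : A = 0
  · subst hA0
    rw [fderiv_zero_of_sq_bound hR hK]
    simp
  by_cases hδ : δA = 0
  · subst hδ
    simp
  have hApos : 0 < ‖A‖ := norm_pos_iff.mpr hA0
  have hδpos : 0 < ‖δA‖ := norm_pos_iff.mpr hδ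
  have hAne : ‖A‖ ≠ 0 := hApos.ne'
  have hδne : ‖δA‖ ≠ 0 := hδpos.ne'
  set r : ℝ := ‖A‖ / ‖δA‖ with hr_def
  have hr : 0 < r := div_pos hApos hδpos
  have hrδ : r * ‖δA‖ = ‖A‖ := div_mul_cancel₀ _ hδne
  have hAr : ‖A‖ + r * ‖δA‖ < R := by rw [hrδ]; linarith
  have h := norm_fderiv_apply_le_of_sq_bound_aux hK0 hf hK hr hAr
  rw [hrδ] at h
  calc ‖fderiv ℂ f A δA‖ ≤ K * (‖A‖ + ‖A‖) ^ 2 / r := h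
    _ = 4 * K * ‖A‖ * ‖δA‖ := by
        rw [hr_def]
        field_simp
        ring

/-- The same estimate for the printed differential (137): `‖dF(A, δA)‖ ≤ 4K‖A‖‖δA‖` for `‖A‖ < R/2`. [folklore] -/
theorem norm_dPair_le_of_sq_bound {f : E → F} {R K : ℝ} (hK0 : 0 ≤ K)
    (hf : DifferentiableOn ℂ f (ball 0 R))
    (hK : ∀ z ∈ ball (0 : E) R, ‖f z‖ ≤ K * ‖z‖ ^ 2)
    {A : E} (hA : ‖A‖ < R / 2) (δA : E) :
    ‖dPair f A δA‖ ≤ 4 * K * ‖A‖ * ‖δA‖ := by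
  have hAin : A ∈ ball (0 : E) R := by
    rw [mem_ball_zero_iff]; have := norm_nonneg A; linarith
  rw [dPair_eq_fderiv (hf.differentiableAt (isOpen_ball.mem_nhds hAin))]
  exact norm_fderiv_apply_le_of_sq_bound hK0 hf hK hA δA

end General

section Bonds

/-! ## The weight `L^{−d}` per variable: configurations on the finite bond set of `B(c₋) ∪ B(c₊)` -/

variable {ι : Type*} [Fintype ι] {G : Type*} [NormedAddCommGroup G]

/-- The operator (140) of B7 p. 39 [PDF 23], *"(Q″A)_c = Σ_{b ⊂ B(c₋)∪B(c₊)} L^{−d} A_b"*, applied to the non-negative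
configuration |δA| as in (148): `Qpp L d δA = Σ_b L^{−d} ‖δA b‖`, the index type `ι` being the finite set of bonds
`b ⊂ B(c₋) ∪ B(c₊)` (`2dL^d − d L^{d−1}`-odd of them; only finiteness is used). [cite: Balaban1985Averaging, (140) p.39] -/
def Qpp (L : ℝ) (d : ℕ) (δA : ι → G) : ℝ :=
  ∑ b, (L ^ d)⁻¹ * ‖δA b‖

/-- `Σ_b ‖δA_b‖ = L^d · (Q″|δA|)_c` (for `L ≠ 0`). [folklore] -/
theorem sum_norm_eq_mul_Qpp (L : ℝ) (d : ℕ) (hL : L ≠ 0) (δA : ι → G) :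
    ∑ b, ‖δA b‖ = L ^ d * Qpp L d δA := by
  unfold Qpp
  rw [Finset.mul_sum]
  refine Finset.sum_congr rfl fun b _ => ?_
  have hLd : L ^ d ≠ 0 := pow_ne_zero d hL
  field_simp

/-- `0 ≤ (Q″|δA|)_c` for `L ≥ 0`. [folklore] -/
theorem Qpp_nonneg (L : ℝ) (d : ℕ) (hL : 0 ≤ L) (δA : ι → G) : 0 ≤ Qpp L d δA :=
  Finset.sum_nonneg fun _ _ => mul_nonneg (inv_nonneg.mpr (pow_nonneg hL d)) (norm_nonneg _)

variable [NormedSpace ℂ G] {F : Type*} [NormedAddCommGroup F] [NormedSpace ℂ F]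

/-- **The weight per variable made explicit.**  For `C` complex-differentiable on the sup-norm ball (= polydisc)
`‖A‖ < R` of configurations `A : ι → G` with `‖C A‖ ≤ K‖A‖²` there, and `‖A‖ < R/2`:
`‖DC(A) δA‖ ≤ 4K ‖A‖ Σ_b ‖δA b‖` — write `δA = Σ_b single_b(δA b)`, use linearity of `DC(A)` and
`‖single_b(δA b)‖_sup = ‖δA b‖`, and apply `norm_fderiv_apply_le_of_sq_bound` to each unit-bond direction. [folklore] -/
theorem norm_fderiv_apply_le_sum {C : (ι → G) → F} {R K : ℝ} (hK0 : 0 ≤ K)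
    (hC : DifferentiableOn ℂ C (ball 0 R))
    (hK : ∀ A ∈ ball (0 : ι → G) R, ‖C A‖ ≤ K * ‖A‖ ^ 2)
    {A : ι → G} (hA : ‖A‖ < R / 2) (δA : ι → G) :
    ‖fderiv ℂ C A δA‖ ≤ 4 * K * ‖A‖ * ∑ b, ‖δA b‖ := by
  classical
  have hsplit : fderiv ℂ C A δA = ∑ b, fderiv ℂ C A (Pi.single b (δA b)) := by
    conv_lhs => rw [← Finset.univ_sum_single δA]
    rw [map_sum]
  rw [hsplit, Finset.mul_sum]
  refine (norm_sum_le _ _).trans (Finset.sum_le_sum fun b _ => ?_)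
  have h := norm_fderiv_apply_le_of_sq_bound hK0 hC hK hA (Pi.single b (δA b))
  rwa [Pi.norm_single] at h

/-- **(148) with the explicit constant `C″₁ = 4C₁L^{d+2}`.**  Hypotheses = the printed properties of the one-step
remainder `C = C(V₀, ·, c)` (Proposition 3 p. 36: analytic in the variables `A_b ∈ 𝔤ᶜ`, `b ⊂ B(c₋) ∪ B(c₊)`, on the
polydisc `|A_b| < c₃`, with (123) `|C(V₀, A, c)| ≤ C₁L²|A|²`), `L > 0`, `C₁ ≥ 0`.  Conclusion, for `|A| < ½c₃` and every
`δA`: `|dC(A, δA)| = |⟨δC(V₀, A)/δA, δA⟩| ≤ 4C₁L^{d+2} · |A| · (Q″|δA|)_c`.  (Here `|A| = ‖A‖` is the sup over the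
variables of `C_c`; the printed global sup is ≥ it, so the printed (148) follows a fortiori.)
[cite: Balaban1985Averaging, (148) p.40] -/
theorem ineq148 {C : (ι → G) → F} {c₃ C₁ L : ℝ} {d : ℕ} (hL : 0 < L) (hC₁ : 0 ≤ C₁)
    (hC : DifferentiableOn ℂ C (ball 0 c₃))
    (h123 : ∀ A ∈ ball (0 : ι → G) c₃, ‖C A‖ ≤ C₁ * L ^ 2 * ‖A‖ ^ 2)
    {A : ι → G} (hA : ‖A‖ < c₃ / 2) (δA : ι → G) :
    ‖dPair C A δA‖ ≤ (4 * C₁ * L ^ (d + 2)) * ‖A‖ * Qpp L d δA := by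
  have hAin : A ∈ ball (0 : ι → G) c₃ := by
    rw [mem_ball_zero_iff]; have := norm_nonneg A; linarith
  rw [dPair_eq_fderiv (hC.differentiableAt (isOpen_ball.mem_nhds hAin))]
  have hK0 : 0 ≤ C₁ * L ^ 2 := by positivity
  have h := norm_fderiv_apply_le_sum hK0 hC h123 hA δA
  rw [sum_norm_eq_mul_Qpp L d hL.ne' δA] at h
  calc ‖fderiv ℂ C A δA‖ ≤ 4 * (C₁ * L ^ 2) * ‖A‖ * (L ^ d * Qpp L d δA) := h
    _ = (4 * C₁ * L ^ (d + 2)) * ‖A‖ * Qpp L d δA := by ring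

/-- **(148)**, p. 40 [PDF 24], typed verbatim as a property of the one-step remainder `C = C(V₀, ·, c)` on a stated
domain: *"|⟨δC(V₀, A)/δA, δA⟩| ≤ C″₁|A|Q″|δA| (148) … The constant C″₁ depends on d and L."* — for all configurations
`A` with `|A| < ρ` and all `δA`, `|dC(A, δA)| ≤ C″₁ · |A| · (Q″|δA|)_c` (pairing (137)/(138) = `dPair`, (140) = `Qpp`).
The print states no domain; `ρ` records the one on which it is used/proved. [cite: Balaban1985Averaging, (148) p.40] -/
def Ineq148Printed (C : (ι → G) → F) (L : ℝ) (d : ℕ) (ρ C₁'' : ℝ) : Prop :=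
  ∀ A : ι → G, ‖A‖ < ρ → ∀ δA : ι → G, ‖dPair C A δA‖ ≤ C₁'' * ‖A‖ * Qpp L d δA

/-- (123) + analyticity on the polydisc `|A_b| < c₃` ⇒ (148) on `|A| < ½c₃` with `C″₁ = 4C₁L^{d+2}` — the disposition
of GAPS G-B7-04 (r1) / C-B7-D (b07), kernel-checked. [cite: Balaban1985Averaging, (123) + (148) pp.36–40] -/
theorem ineq148Printed_of_123 {C : (ι → G) → F} {c₃ C₁ L : ℝ} {d : ℕ} (hL : 0 < L) (hC₁ : 0 ≤ C₁)
    (hC : DifferentiableOn ℂ C (ball 0 c₃))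
    (h123 : ∀ A ∈ ball (0 : ι → G) c₃, ‖C A‖ ≤ C₁ * L ^ 2 * ‖A‖ ^ 2) :
    Ineq148Printed C L d (c₃ / 2) (4 * C₁ * L ^ (d + 2)) :=
  fun _ hA δA => ineq148 hL hC₁ hC h123 hA δA

end Bonds

end Literature.MathematicalPhysics.QuantumFieldTheory.Balaban1983to89.B7Ineq148

end
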